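import Summits.QuantumAdvantage.QuantumAdvantage.Theorems.CubicForrelationNearExactIsExactTwelveLevelFiveRigidSign

/-!
# Crux `CubicForrelation.NearExactIsExact` (stmt-QuantumAdvantage-14043) — n = 12, open window `(57/64, 29/32)`: a RIGID level-5 side with
  `4 ∣ e₅` off the odd hyperplane forces a TYPE-O PARTNER (level-5 and level-`≥ 6` partners are impossible)

Certificate seat `b2b-cforr-cert` (gen 29).  HONEST FRAMING: kernel-checked finite-slice lemmas (standard axioms) about cubic Boolean pairs on 12
bits — the Parseval squeeze of gen 27 (…TwelveLevelFiveGenericDead) run with the RIGID PROXY `S' = σ₅·1_P − 4σ₅·1_{L₅}` (so `8 ∣ e₅ − S'` on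
`P`) instead of `σ₅·1_P`: by …RigidFlat/…RigidRadical/…RigidSign `#L₅ = 128` and `Ŝ' ∈ 512ℤ`, so
`Σ_y (128(−1)^g − 2W_f − Ŝ')² = 4096·Σ_x (e₅ − S')² ≤ 4096·2044`, while a level-5 partner gives `≥ 2048·4096` (each of its `≥ 2048` odd
frequencies contributes `≥ 64²`, whatever `Ŝ' ∈ 128ℤ` is) and a level-`≥ 6` partner is excluded by `tz_levelSix_window_false`.  Hence the
partner of a rigid level-5 side is of TYPE O.  The type-O case is NOT settled here.  NO value of `θ₁₂` is claimed; NOT summit progress.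

* `tzu_pw_L`: `8 ∣ e + 3σ` ⇒ `(e + 3σ)² ≤ 4(e² − 9)`.      * `tzu_pi_bound`: `Σ_x (e₅ − S')² ≤ 2044` on the budget `Σ_P(e₅² − 1) + E_off ≤ 1535`.
* `tzu_Shat`, `tzu_W_eq`: `Σ_a S'(a)(−1)^{a·y} = M(y) − 4T(y)`, `W(e₅ − S') = 128(−1)^g − 2W_f − (M − 4T)`.      * `tzu_bridge`: `Σ_y (128(−1)^{g(y)} − 2W_f(y) − (M − 4T)(y))² ≤ 4096·2044`.
* `tzu_not_levelFive_partner`, `tzu_rigid_partner_typeO` (window packaging: the partner `f` has `W_f = 16u` with every `u(y)` odd).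
* `tzv_q_lower`: against a type-O partner the same Parseval sum is `≥ 4096·1984` (`≥ 96²` on the `≥ 512 − 32` frequencies of `E_f` off the
  support of `S_R`), i.e. `Σ_x (e₅ − S')² ≥ 1984` — the input of the final squeeze in …TwelveLevelFiveRigidDead.

References: MacWilliams–Sloane (1977) Ch. 14–15; R. O'Donnell (2014) §1.4 (Parseval); C. Carlet (2021) §5.2.  Axioms: the standard three.
-/

set_option linter.dupNamespace false -- D-0017: single-problem summit ⇒ `QuantumAdvantage.QuantumAdvantage` by design

noncomputable section

namespace Summit.QuantumAdvantage.QuantumAdvantage.Theorems.CubicForrelation.NearExactIsExact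

open Finset
open Literature.Computability.QuantumComplexity
open Literature.Computability.QuantumComplexity.BuzetChailloux (bxor zeroVec bxor_bxor_cancel_left bxor_zeroVec zeroVec_bxor bxor_comm
  bxor_self)
open Literature.Computability.QuantumComplexity.DerivativeWalsh (W sum_W_sq twist_bxor_left)

/-! ### Pointwise -/

/-- `σ = ±1`, `8 ∣ e + 3σ` ⇒ `(e + 3σ)² ≤ 4(e² − 9)` (`e = −3σ + 8k`: `64k² ≤ 256k² − 192σk` iff `k(k − σ) ≥ 0`). [folklore] -/
theorem tzu_pw_L {e σ : ℤ} (hσ : σ = 1 ∨ σ = -1) (h8 : (8 : ℤ) ∣ e + 3 * σ) : (e + 3 * σ) ^ 2 ≤ 4 * (e ^ 2 - 9) := by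
  obtain ⟨k, hk⟩ := h8
  have he : e = -3 * σ + 8 * k := by linarith
  subst he
  have hkk : 0 ≤ k * (k - σ) := by
    rcases hσ with rfl | rfl
    · rcases le_or_gt k 0 with h | h
      · nlinarith
      · nlinarith
    · rcases le_or_gt 0 k with h | h
      · nlinarith
      · nlinarith
  rcases hσ with rfl | rfl <;> nlinarith

/-- On the odd hyperplane: `4 ∣ e − σ` and `8 ∤ e − σ` ⇒ `8 ∣ e + 3σ` (`σ = ±1`). [folklore] -/
theorem tzu_dvd_L {e σ : ℤ} (hσ : σ = 1 ∨ σ = -1) (h4 : (4 : ℤ) ∣ e - σ) (h8 : ¬ (8 : ℤ) ∣ e - σ) : (8 : ℤ) ∣ e + 3 * σ := by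
  obtain ⟨j, hj⟩ := h4
  have hjodd : j % 2 = 1 := by
    by_contra hne
    apply h8
    exact ⟨j / 2, by omega⟩
  rcases hσ with rfl | rfl
  · exact ⟨(j + 1) / 2, by omega⟩
  · exact ⟨(j - 1) / 2, by omega⟩

/-! ### The perturbation bound with the rigid proxy -/

/-- **`Σ_x (e₅ − S')² ≤ 2044`** for the rigid proxy `S'(x) = σ₅(x)` on `P ∖ L₅`, `−3σ₅(x)` on `L₅`, `0` off `P` — rigid bookkeeping of
…TwelveLevelFiveRigid on the budget `Σ_P (e₅² − 1) + E_off ≤ 1535` (pointwise `(e₅ − S')² ≤ 4(e₅² − w)` with `w = 1, 9, 0` on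
`P ∖ L₅, L₅, P^c`, and `Σ w = 2048 + 8·#L₅ = 3072` by `tzq_L5_card`). [this work] -/
theorem tzu_pi_bound (f g : (Fin (6 + 6) → Bool) → Bool) (hf : IsDegLeFun 3 f) (hg : IsDegLeFun 3 g)
    (u' : (Fin (6 + 6) → Bool) → ℤ) (hu' : ∀ x, W (fun y => signOf (g y)) x = (2 : ℝ) ^ 5 * (u' x : ℝ))
    (V : Finset (Fin (6 + 6) → Bool)) (x₀ : Fin (6 + 6) → Bool) (h0 : zeroVec ∈ V) (hadd : ∀ a ∈ V, ∀ b ∈ V, bxor a b ∈ V)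
    (hcardV : #V = 2048) (hP : (univ.filter fun x : Fin (6 + 6) → Bool => Odd (u' x)) = V.image (bxor x₀))
    (h4off : ∀ y, ¬ Odd (u' y) → (4 : ℤ) ∣ u' y - 2 * sZ (f y))
    (hoff : ∑ y ∈ univ.filter (fun y : Fin (6 + 6) → Bool => ¬ Odd (u' y)), (u' y - 2 * sZ (f y)) ^ 2 ≤ 2047)
    (hb : (Fin (6 + 6) → Bool) → Bool) (hhb : ∀ z, hb z = decide ((u' z - 2 * sZ (f z)) % 4 = 3))
    (htot : ∑ x ∈ univ.filter (fun x : Fin (6 + 6) → Bool => Odd (u' x)), ((u' x - 2 * sZ (f x)) ^ 2 - 1) +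
      ∑ y ∈ univ.filter (fun y : Fin (6 + 6) → Bool => ¬ Odd (u' y)), (u' y - 2 * sZ (f y)) ^ 2 ≤ 1535)
    (hL : ∃ x, Odd (u' x) ∧ ¬ (8 : ℤ) ∣ u' x - 2 * sZ (f x) - sZ (hb x)) :
    (∑ x, (u' x - 2 * sZ (f x) - (fun x : Fin (6 + 6) → Bool => if Odd (u' x) then (if ¬ (8 : ℤ) ∣ u' x - 2 * sZ (f x) - sZ (hb x) then -3 * sZ (hb x) else sZ (hb x)) else 0) x) ^ 2 : ℤ) ≤ 2044 := by
  classical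
  set P := (univ.filter fun x : Fin (6 + 6) → Bool => Odd (u' x)) with hPdef
  set e : (Fin (6 + 6) → Bool) → ℤ := fun x => u' x - 2 * sZ (f x) with hedef
  have hmemP : ∀ x, x ∈ P ↔ Odd (u' x) := fun x => by simp [hPdef]
  have hPcard : #P = 2048 := by rw [hP, card_image_of_injective _ (iw_bxor_injective x₀), hcardV]
  have hEnn : (0 : ℤ) ≤ ∑ y ∈ univ.filter (fun y : Fin (6 + 6) → Bool => ¬ Odd (u' y)), e y ^ 2 := sum_nonneg fun _ _ => sq_nonneg _
  have hbud : ∑ x ∈ P, (e x ^ 2 - 1) ≤ 1535 := by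
    have := htot; linarith
  have h128 := tzq_L5_card f g hf hg u' hu' V x₀ h0 hadd hcardV hP h4off hoff hb hhb hbud hL
  -- weights
  set w : (Fin (6 + 6) → Bool) → ℤ := fun x => if Odd (u' x) then (if ¬ (8 : ℤ) ∣ u' x - 2 * sZ (f x) - sZ (hb x) then 9 else 1) else 0 with hwdef
  -- pointwise bound `(e − S')² ≤ 4(e² − w)`
  have hpt : ∀ x, (e x - (fun x : Fin (6 + 6) → Bool => if Odd (u' x) then (if ¬ (8 : ℤ) ∣ u' x - 2 * sZ (f x) - sZ (hb x) then -3 * sZ (hb x) else sZ (hb x)) else 0) x) ^ 2 ≤ 4 * (e x ^ 2 - w x) := by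
    intro x
    by_cases hx : Odd (u' x)
    · have hσ := tp_sZ_cases (hb x)
      have h4 : (4 : ℤ) ∣ e x - sZ (hb x) := by
        have := tzl5_mod4 f u' hx; rw [hhb]; exact this
      by_cases hQ : ¬ (8 : ℤ) ∣ u' x - 2 * sZ (f x) - sZ (hb x)
      · simp only [w]; rw [if_pos hx, if_pos hQ, if_pos hx, if_pos hQ]
        have h8 : (8 : ℤ) ∣ e x + 3 * sZ (hb x) := tzu_dvd_L hσ h4 hQ
        have := tzu_pw_L hσ h8
        have ee : e x - -3 * sZ (hb x) = e x + 3 * sZ (hb x) := by ring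
        rw [ee]; exact this
      · simp only [w]; rw [if_pos hx, if_neg hQ, if_pos hx, if_neg hQ]
        have h8 : (8 : ℤ) ∣ e x - sZ (hb x) := not_not.1 hQ
        have h3 := tzc_pw_three hσ h8
        have hodd : Odd (e x) := Int.odd_sub.2 (iff_of_true hx ⟨sZ (f x), two_mul _⟩)
        have ho := Int.odd_iff.1 hodd
        have h1 : (1 : ℤ) ≤ e x ^ 2 := by
          have : e x ≤ -1 ∨ 1 ≤ e x := by omega
          rcases this with h | h <;> nlinarith
        nlinarith [sq_nonneg (e x - sZ (hb x))]
    · simp only [w]; rw [if_neg hx, if_neg hx]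
      nlinarith [sq_nonneg (e x)]
  -- `Σ w = 2048 + 8·128`
  have hw : ∑ x, w x = 3072 := by
    have hsplit : ∑ x, w x = ∑ x ∈ P, w x + ∑ x ∈ univ.filter (fun x => ¬ Odd (u' x)), w x :=
      (sum_filter_add_sum_filter_not (s := (univ : Finset (Fin (6 + 6) → Bool))) (p := fun x => Odd (u' x)) (f := w)).symm
    have hoffw : ∑ x ∈ univ.filter (fun x => ¬ Odd (u' x)), w x = 0 :=
      sum_eq_zero fun x hx => by simp only [w]; rw [if_neg (mem_filter.1 hx).2]
    have honw : ∑ x ∈ P, w x = ∑ x ∈ P, (1 + 8 * (if ¬ (8 : ℤ) ∣ u' x - 2 * sZ (f x) - sZ (hb x) then (1 : ℤ) else 0)) :=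
      sum_congr rfl fun x hx => by
        simp only [w]; rw [if_pos ((hmemP x).1 hx)]
        split_ifs <;> norm_num
    rw [hsplit, hoffw, honw, sum_add_distrib, sum_const, hPcard, ← mul_sum, sum_boole]
    have hLP : (P.filter fun x => ¬ (8 : ℤ) ∣ u' x - 2 * sZ (f x) - sZ (hb x)) = (univ.filter fun z : Fin (6 + 6) → Bool => Odd (u' z) ∧ ¬ (8 : ℤ) ∣ u' z - 2 * sZ (f z) - sZ (hb z)) := by
      simp only [hPdef, filter_filter]
    rw [hLP, h128]
    norm_num
  -- `Σ e² ≤ 3583`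
  have he2 : (∑ x, e x ^ 2 : ℤ) ≤ 3583 := by
    have hsplit : (∑ x, e x ^ 2 : ℤ) = ∑ x ∈ P, e x ^ 2 + ∑ x ∈ univ.filter (fun x => ¬ Odd (u' x)), e x ^ 2 :=
      (sum_filter_add_sum_filter_not (s := (univ : Finset (Fin (6 + 6) → Bool))) (p := fun x => Odd (u' x)) (f := fun x => e x ^ 2)).symm
    have hPsum : ∑ x ∈ P, (e x ^ 2 - 1) = ∑ x ∈ P, e x ^ 2 - 2048 := by
      rw [sum_sub_distrib, sum_const, hPcard]; norm_num
    have := htot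
    rw [hPsum] at this
    linarith
  calc (∑ x, (e x - (fun x : Fin (6 + 6) → Bool => if Odd (u' x) then (if ¬ (8 : ℤ) ∣ u' x - 2 * sZ (f x) - sZ (hb x) then -3 * sZ (hb x) else sZ (hb x)) else 0) x) ^ 2 : ℤ)
      ≤ ∑ x, 4 * (e x ^ 2 - w x) := sum_le_sum fun x _ => hpt x
    _ = 4 * ((∑ x, e x ^ 2) - ∑ x, w x) := by rw [← mul_sum, sum_sub_distrib]
    _ ≤ 2044 := by rw [hw]; linarith

/-! ### The transform of the proxy and the bridge -/

/-- **`Σ_a S'(a)(−1)^{a·y} = M(y) − 4T(y)`** (`S' = σ₅·1_P − 4σ₅·1_{L₅}`). [this work] -/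
theorem tzu_Shat (f : (Fin (6 + 6) → Bool) → Bool) (u' : (Fin (6 + 6) → Bool) → ℤ) (hb : (Fin (6 + 6) → Bool) → Bool)
    (y : Fin (6 + 6) → Bool) :
    ∑ a, (((fun x : Fin (6 + 6) → Bool => if Odd (u' x) then (if ¬ (8 : ℤ) ∣ u' x - 2 * sZ (f x) - sZ (hb x) then -3 * sZ (hb x) else sZ (hb x)) else 0) a : ℤ) : ℝ) * twist a y =
      ∑ x ∈ (univ.filter fun x : Fin (6 + 6) → Bool => Odd (u' x)), signOf (hb x) * twist x y - 4 * ∑ x ∈ (univ.filter fun z : Fin (6 + 6) → Bool => Odd (u' z) ∧ ¬ (8 : ℤ) ∣ u' z - 2 * sZ (f z) - sZ (hb z)), signOf (hb x) * twist x y := by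
  classical
  have hpt : ∀ a, (((fun x : Fin (6 + 6) → Bool => if Odd (u' x) then (if ¬ (8 : ℤ) ∣ u' x - 2 * sZ (f x) - sZ (hb x) then -3 * sZ (hb x) else sZ (hb x)) else 0) a : ℤ) : ℝ) * twist a y =
      (if Odd (u' a) then signOf (hb a) * twist a y else 0) -
        4 * (if (Odd (u' a) ∧ ¬ (8 : ℤ) ∣ u' a - 2 * sZ (f a) - sZ (hb a)) then signOf (hb a) * twist a y else 0) := by
    intro a
    dsimp only
    by_cases ha : Odd (u' a)
    · by_cases hQ : ¬ (8 : ℤ) ∣ u' a - 2 * sZ (f a) - sZ (hb a)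
      · rw [if_pos (show Odd (u' a) ∧ ¬ (8 : ℤ) ∣ u' a - 2 * sZ (f a) - sZ (hb a) from ⟨ha, hQ⟩)]
        simp only [if_pos ha, if_pos hQ]
        push_cast
        rw [tp_sZ_cast]; ring
      · rw [if_neg (show ¬ (Odd (u' a) ∧ ¬ (8 : ℤ) ∣ u' a - 2 * sZ (f a) - sZ (hb a)) from fun h => hQ h.2)]
        simp only [if_pos ha, if_neg hQ, tp_sZ_cast]
        ring
    · rw [if_neg (show ¬ (Odd (u' a) ∧ ¬ (8 : ℤ) ∣ u' a - 2 * sZ (f a) - sZ (hb a)) from fun h => ha h.1)]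
      simp only [if_neg ha]
      push_cast; ring
  rw [sum_congr rfl (fun a _ => hpt a), sum_sub_distrib, ← mul_sum, ← sum_filter, ← sum_filter]

/-- **`W(e₅ − S')(y) = 128(−1)^{g(y)} − 2W_f(y) − (M(y) − 4T(y))`** (Walsh inversion `tzl5_ehat` and `tzu_Shat`). [this work] -/
theorem tzu_W_eq (f g : (Fin (6 + 6) → Bool) → Bool)
    (u' : (Fin (6 + 6) → Bool) → ℤ) (hu' : ∀ x, W (fun y => signOf (g y)) x = (2 : ℝ) ^ 5 * (u' x : ℝ))
    (hb : (Fin (6 + 6) → Bool) → Bool) (y : Fin (6 + 6) → Bool) :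
    W (fun a => (((u' a - 2 * sZ (f a) - (fun x : Fin (6 + 6) → Bool => if Odd (u' x) then (if ¬ (8 : ℤ) ∣ u' x - 2 * sZ (f x) - sZ (hb x) then -3 * sZ (hb x) else sZ (hb x)) else 0) a : ℤ)) : ℝ)) y =
      128 * signOf (g y) - 2 * W (fun x => signOf (f x)) y -
        (∑ x ∈ (univ.filter fun x : Fin (6 + 6) → Bool => Odd (u' x)), signOf (hb x) * twist x y - 4 * ∑ x ∈ (univ.filter fun z : Fin (6 + 6) → Bool => Odd (u' z) ∧ ¬ (8 : ℤ) ∣ u' z - 2 * sZ (f z) - sZ (hb z)), signOf (hb x) * twist x y) := by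
  show ∑ a, (((u' a - 2 * sZ (f a) - (fun x : Fin (6 + 6) → Bool => if Odd (u' x) then (if ¬ (8 : ℤ) ∣ u' x - 2 * sZ (f x) - sZ (hb x) then -3 * sZ (hb x) else sZ (hb x)) else 0) a : ℤ)) : ℝ) * twist a y = _
  have h1 : ∑ a, (((u' a - 2 * sZ (f a) - (fun x : Fin (6 + 6) → Bool => if Odd (u' x) then (if ¬ (8 : ℤ) ∣ u' x - 2 * sZ (f x) - sZ (hb x) then -3 * sZ (hb x) else sZ (hb x)) else 0) a : ℤ)) : ℝ) * twist a y =
      ∑ a, (((u' a - 2 * sZ (f a) : ℤ)) : ℝ) * twist a y - ∑ a, (((fun x : Fin (6 + 6) → Bool => if Odd (u' x) then (if ¬ (8 : ℤ) ∣ u' x - 2 * sZ (f x) - sZ (hb x) then -3 * sZ (hb x) else sZ (hb x)) else 0) a : ℤ) : ℝ) * twist a y := by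
    rw [← sum_sub_distrib]; exact sum_congr rfl fun x _ => by push_cast; ring
  rw [h1, tzu_Shat f u' hb y, tzl5_ehat f g u' hu' y]

/-- **The bridge**: `Σ_y (128(−1)^{g(y)} − 2W_f(y) − (M(y) − 4T(y)))² ≤ 4096·2044` in the rigid case on the window budget (Parseval for
`e₅ − S'`, `tzl5_ehat`, `tzu_Shat`, `tzu_pi_bound`). [this work] -/
theorem tzu_bridge (f g : (Fin (6 + 6) → Bool) → Bool) (hf : IsDegLeFun 3 f) (hg : IsDegLeFun 3 g)
    (u' : (Fin (6 + 6) → Bool) → ℤ) (hu' : ∀ x, W (fun y => signOf (g y)) x = (2 : ℝ) ^ 5 * (u' x : ℝ))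
    (V : Finset (Fin (6 + 6) → Bool)) (x₀ : Fin (6 + 6) → Bool) (h0 : zeroVec ∈ V) (hadd : ∀ a ∈ V, ∀ b ∈ V, bxor a b ∈ V)
    (hcardV : #V = 2048) (hP : (univ.filter fun x : Fin (6 + 6) → Bool => Odd (u' x)) = V.image (bxor x₀))
    (h4off : ∀ y, ¬ Odd (u' y) → (4 : ℤ) ∣ u' y - 2 * sZ (f y))
    (hoff : ∑ y ∈ univ.filter (fun y : Fin (6 + 6) → Bool => ¬ Odd (u' y)), (u' y - 2 * sZ (f y)) ^ 2 ≤ 2047)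
    (hb : (Fin (6 + 6) → Bool) → Bool) (hhb : ∀ z, hb z = decide ((u' z - 2 * sZ (f z)) % 4 = 3))
    (htot : ∑ x ∈ univ.filter (fun x : Fin (6 + 6) → Bool => Odd (u' x)), ((u' x - 2 * sZ (f x)) ^ 2 - 1) +
      ∑ y ∈ univ.filter (fun y : Fin (6 + 6) → Bool => ¬ Odd (u' y)), (u' y - 2 * sZ (f y)) ^ 2 ≤ 1535)
    (hL : ∃ x, Odd (u' x) ∧ ¬ (8 : ℤ) ∣ u' x - 2 * sZ (f x) - sZ (hb x)) :
    ∑ y, (128 * signOf (g y) - 2 * W (fun x => signOf (f x)) y -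
      (∑ x ∈ (univ.filter fun x : Fin (6 + 6) → Bool => Odd (u' x)), signOf (hb x) * twist x y - 4 * ∑ x ∈ (univ.filter fun z : Fin (6 + 6) → Bool => Odd (u' z) ∧ ¬ (8 : ℤ) ∣ u' z - 2 * sZ (f z) - sZ (hb z)), signOf (hb x) * twist x y)) ^ 2 ≤ 4096 * 2044 := by
  classical
  set S := (fun x : Fin (6 + 6) → Bool => if Odd (u' x) then (if ¬ (8 : ℤ) ∣ u' x - 2 * sZ (f x) - sZ (hb x) then -3 * sZ (hb x) else sZ (hb x)) else 0) with hSdef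
  set e : (Fin (6 + 6) → Bool) → ℤ := fun x => u' x - 2 * sZ (f x) with hedef
  have hpi : (∑ x, (e x - S x) ^ 2 : ℤ) ≤ 2044 := tzu_pi_bound f g hf hg u' hu' V x₀ h0 hadd hcardV hP h4off hoff hb hhb htot hL
  have hW : ∀ y, W (fun a => (((e a - S a : ℤ)) : ℝ)) y = 128 * signOf (g y) - 2 * W (fun x => signOf (f x)) y -
      (∑ x ∈ (univ.filter fun x : Fin (6 + 6) → Bool => Odd (u' x)), signOf (hb x) * twist x y - 4 * ∑ x ∈ (univ.filter fun z : Fin (6 + 6) → Bool => Odd (u' z) ∧ ¬ (8 : ℤ) ∣ u' z - 2 * sZ (f z) - sZ (hb z)), signOf (hb x) * twist x y) :=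
    fun y => tzu_W_eq f g u' hu' hb y
  have hP2 := sum_W_sq (fun a => (((e a - S a : ℤ)) : ℝ))
  simp_rw [hW] at hP2
  rw [hP2]
  have h1 : ∑ x, ((((e x - S x : ℤ)) : ℝ)) ^ 2 = ((∑ x, (e x - S x) ^ 2 : ℤ) : ℝ) := by push_cast; rfl
  have h2 : ((∑ x, (e x - S x) ^ 2 : ℤ) : ℝ) ≤ 2044 := by exact_mod_cast hpi
  rw [h1, show ((2 : ℝ) ^ (6 + 6)) = 4096 by norm_num]
  linarith

/-! ### Level-5 partners are impossible -/

/-- Pointwise: `u` odd, `s = ±1`, `k` integer ⇒ `(128 s − 64u − 512k)² ≥ 4096`. [folklore] -/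
theorem tzu_levelFive_pt (u s k : ℤ) (hu : Odd u) (hs : s = 1 ∨ s = -1) : 4096 ≤ (128 * s - 64 * u - 512 * k) ^ 2 := by
  have ho := Int.odd_iff.1 hu
  have : 128 * s - 64 * u - 512 * k ≤ -64 ∨ 64 ≤ 128 * s - 64 * u - 512 * k := by rcases hs with rfl | rfl <;> omega
  rcases this with h | h <;> nlinarith

/-- **No level-5 partner for a rigid level-5 side.**  Rigid bookkeeping on the budget `Σ_P (e₅² − 1) + E_off ≤ 1535`, `L₅ ≠ ∅`, and a partner
with `W_f = 32u'_f`, some `u'_f` odd ⇒ `False`: the `≥ 2048` odd frequencies of `u'_f` (`tzp_levelFive_card`) each contribute `≥ 64²` to the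
bridge sum (`Ŝ' ∈ 512ℤ`, `tzt_Shat_val`), exceeding `4096·2044`. [this work] -/
theorem tzu_not_levelFive_partner (f g : (Fin (6 + 6) → Bool) → Bool) (hf : IsDegLeFun 3 f) (hg : IsDegLeFun 3 g)
    (u' : (Fin (6 + 6) → Bool) → ℤ) (hu' : ∀ x, W (fun y => signOf (g y)) x = (2 : ℝ) ^ 5 * (u' x : ℝ))
    (V : Finset (Fin (6 + 6) → Bool)) (x₀ : Fin (6 + 6) → Bool) (h0 : zeroVec ∈ V) (hadd : ∀ a ∈ V, ∀ b ∈ V, bxor a b ∈ V)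
    (hcardV : #V = 2048) (hP : (univ.filter fun x : Fin (6 + 6) → Bool => Odd (u' x)) = V.image (bxor x₀))
    (h4off : ∀ y, ¬ Odd (u' y) → (4 : ℤ) ∣ u' y - 2 * sZ (f y))
    (hoff : ∑ y ∈ univ.filter (fun y : Fin (6 + 6) → Bool => ¬ Odd (u' y)), (u' y - 2 * sZ (f y)) ^ 2 ≤ 2047)
    (hb : (Fin (6 + 6) → Bool) → Bool) (hhb : ∀ z, hb z = decide ((u' z - 2 * sZ (f z)) % 4 = 3))
    (htot : ∑ x ∈ univ.filter (fun x : Fin (6 + 6) → Bool => Odd (u' x)), ((u' x - 2 * sZ (f x)) ^ 2 - 1) +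
      ∑ y ∈ univ.filter (fun y : Fin (6 + 6) → Bool => ¬ Odd (u' y)), (u' y - 2 * sZ (f y)) ^ 2 ≤ 1535)
    (hL : ∃ x, Odd (u' x) ∧ ¬ (8 : ℤ) ∣ u' x - 2 * sZ (f x) - sZ (hb x))
    (uf : (Fin (6 + 6) → Bool) → ℤ) (huf : ∀ y, W (fun x => signOf (f x)) y = (2 : ℝ) ^ 5 * (uf y : ℝ)) (hfodd : ∃ y, Odd (uf y)) :
    False := by
  classical
  have hEnn : (0 : ℤ) ≤ ∑ y ∈ univ.filter (fun y : Fin (6 + 6) → Bool => ¬ Odd (u' y)), (u' y - 2 * sZ (f y)) ^ 2 :=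
    sum_nonneg fun _ _ => sq_nonneg _
  have hbud : ∑ x ∈ univ.filter (fun x : Fin (6 + 6) → Bool => Odd (u' x)), ((u' x - 2 * sZ (f x)) ^ 2 - 1) ≤ 1535 := by linarith
  have hbridge := tzu_bridge f g hf hg u' hu' V x₀ h0 hadd hcardV hP h4off hoff hb hhb htot hL
  set Mf : (Fin (6 + 6) → Bool) → ℝ := fun y =>
    ∑ x ∈ (univ.filter fun x : Fin (6 + 6) → Bool => Odd (u' x)), signOf (hb x) * twist x y - 4 * ∑ x ∈ (univ.filter fun z : Fin (6 + 6) → Bool => Odd (u' z) ∧ ¬ (8 : ℤ) ∣ u' z - 2 * sZ (f z) - sZ (hb z)), signOf (hb x) * twist x y with hMf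
  have hP'card := tzp_levelFive_card f hf uf huf hfodd
  set P' := univ.filter (fun y : Fin (6 + 6) → Bool => Odd (uf y)) with hP'def
  have hpt : ∀ y, (4096 : ℝ) * (if y ∈ P' then (1 : ℝ) else 0) ≤ (128 * signOf (g y) - 2 * W (fun x => signOf (f x)) y - Mf y) ^ 2 := by
    intro y
    by_cases hyP : y ∈ P'
    · rw [if_pos hyP, mul_one]
      obtain ⟨k, -, hk⟩ := tzt_Shat_val f g hf hg u' hu' V x₀ h0 hadd hcardV hP h4off hoff hb hhb hbud hL y
      have hMk : Mf y = 512 * (k : ℝ) := hk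
      rw [hMk, huf y, ← tp_sZ_cast (g y)]
      have e1 : (128 * ((sZ (g y) : ℤ) : ℝ) - 2 * ((2 : ℝ) ^ 5 * (uf y : ℝ)) - 512 * (k : ℝ)) ^ 2 =
          (((128 * sZ (g y) - 64 * uf y - 512 * k) ^ 2 : ℤ) : ℝ) := by push_cast; ring
      rw [e1]
      exact_mod_cast tzu_levelFive_pt (uf y) (sZ (g y)) k (mem_filter.1 hyP).2 (tp_sZ_cases (g y))
    · rw [if_neg hyP, mul_zero]; exact sq_nonneg _
  have hsum := sum_le_sum fun y (_ : y ∈ (univ : Finset (Fin (6 + 6) → Bool))) => hpt y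
  have hindP : ∑ y, (if y ∈ P' then (1 : ℝ) else 0) = #P' := by
    rw [sum_boole]
    have : (univ.filter fun y => y ∈ P') = P' := by ext y; simp
    rw [this]
  rw [← mul_sum, hindP] at hsum
  have hP'' : (2048 : ℝ) ≤ #P' := by exact_mod_cast hP'card
  linarith

/-! ### Packaging on the open window: the partner is of type O -/

/-- **A rigid level-5 side on the open window has a TYPE-O partner.**  Cubic `f, g` on 12 bits, `W_g = 32u'` with some `u'` odd,
`57/64 < Φ(f,g) < 1`, `4 ∣ e₅` off the odd set, and some point of the odd set with `e₅ ≢ σ₅ (mod 8)`.  Then `W_f = 16u` with every `u(y)` odd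
(level-5 partners by `tzu_not_levelFive_partner`, level `≥ 6` by `tz_levelSix_window_false` with the roles swapped).  The type-O case is NOT
excluded here.  Finite-slice statement, NOT summit progress. [this work] -/
theorem tzu_rigid_partner_typeO (f g : (Fin (6 + 6) → Bool) → Bool) (hf : IsDegLeFun 3 f) (hg : IsDegLeFun 3 g)
    (u' : (Fin (6 + 6) → Bool) → ℤ) (hu' : ∀ x, W (fun y => signOf (g y)) x = (2 : ℝ) ^ 5 * (u' x : ℝ)) (hodd : ∃ x, Odd (u' x))
    (hlo : (57 / 64 : ℝ) < forrelation f g) (hhi : forrelation f g < 1)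
    (h4off : ∀ y, ¬ Odd (u' y) → (4 : ℤ) ∣ u' y - 2 * sZ (f y))
    (hb : (Fin (6 + 6) → Bool) → Bool) (hhb : ∀ z, hb z = decide ((u' z - 2 * sZ (f z)) % 4 = 3))
    (hL : ∃ x, Odd (u' x) ∧ ¬ (8 : ℤ) ∣ u' x - 2 * sZ (f x) - sZ (hb x)) :
    ∃ u : (Fin (6 + 6) → Bool) → ℤ, (∀ y, W (fun x => signOf (f x)) y = (2 : ℝ) ^ 4 * (u y : ℝ)) ∧ ∀ y, Odd (u y) := by
  classical
  obtain ⟨V, x₀, h0, hadd, hcardV, hP, -, -, -, -, h511, htot⟩ :=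
    tzr_window_rigid f g hf hg u' hu' hodd hlo h4off hb hhb hL
  have hoff : ∑ y ∈ univ.filter (fun y : Fin (6 + 6) → Bool => ¬ Odd (u' y)), (u' y - 2 * sZ (f y)) ^ 2 ≤ 2047 := by linarith
  obtain ⟨u₄, hu₄⟩ := tw_base (n := 6 + 6) f hf 4 (by norm_num)
  refine ⟨u₄, hu₄, ?_⟩
  by_contra hO
  push Not at hO
  obtain ⟨y₁, hy₁⟩ := hO
  by_cases hO' : ∃ y, Odd (u₄ y)
  · exact hy₁ ((Summit.QuantumAdvantage.QuantumAdvantage.Theorems.NearExactIsExact.Negative.TypeOTwelve.typeO_of_exists_odd f u₄ hf hu₄ hO') y₁)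
  push Not at hO'
  have hu₅ : ∀ y, W (fun x => signOf (f x)) y = (2 : ℝ) ^ 5 * (((u₄ y / 2 : ℤ)) : ℝ) :=
    fun y => (tw_level_up (j := 4) f u₄ hu₄ hO' y).trans (by norm_num)
  by_cases h5 : ∃ y, Odd (u₄ y / 2)
  · exact tzu_not_levelFive_partner f g hf hg u' hu' V x₀ h0 hadd hcardV hP h4off hoff hb hhb htot hL (fun y => u₄ y / 2) hu₅ h5
  · push Not at h5
    have hu₆ : ∀ y, W (fun x => signOf (f x)) y = (2 : ℝ) ^ 6 * (((u₄ y / 2 / 2 : ℤ)) : ℝ) :=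
      fun y => (tw_level_up (j := 5) f (fun y => u₄ y / 2) hu₅ h5 y).trans (by norm_num)
    have hΦ' : forrelation g f = forrelation f g := by
      rw [Summit.QuantumAdvantage.QuantumAdvantage.Theorems.SignedCubicForrelationNotPrBPP.Negative.HalfQuad.forrelation_comm]
    exact tz_levelSix_window_false g f hg hf (fun y => u₄ y / 2 / 2) hu₆ (by rw [hΦ']; exact hlo) (by rw [hΦ']; exact hhi)

/-! ### The Parseval lower bound against a type-O partner -/

/-- **`Σ_x (e₅ − S')² ≥ 1984` against a type-O partner** (`W_f = 16u_f`, every `u_f` odd, `#{u_f ≡ ±1 (8)} ≥ 512`), rigid case on the window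
budget. [this work] -/
theorem tzv_q_lower (f g : (Fin (6 + 6) → Bool) → Bool) (hf : IsDegLeFun 3 f) (hg : IsDegLeFun 3 g)
    (u' : (Fin (6 + 6) → Bool) → ℤ) (hu' : ∀ x, W (fun y => signOf (g y)) x = (2 : ℝ) ^ 5 * (u' x : ℝ))
    (V : Finset (Fin (6 + 6) → Bool)) (x₀ : Fin (6 + 6) → Bool) (h0 : zeroVec ∈ V) (hadd : ∀ a ∈ V, ∀ b ∈ V, bxor a b ∈ V)
    (hcardV : #V = 2048) (hP : (univ.filter fun x : Fin (6 + 6) → Bool => Odd (u' x)) = V.image (bxor x₀))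
    (h4off : ∀ y, ¬ Odd (u' y) → (4 : ℤ) ∣ u' y - 2 * sZ (f y))
    (hoff : ∑ y ∈ univ.filter (fun y : Fin (6 + 6) → Bool => ¬ Odd (u' y)), (u' y - 2 * sZ (f y)) ^ 2 ≤ 2047)
    (hb : (Fin (6 + 6) → Bool) → Bool) (hhb : ∀ z, hb z = decide ((u' z - 2 * sZ (f z)) % 4 = 3))
    (hbud : ∑ x ∈ univ.filter (fun x : Fin (6 + 6) → Bool => Odd (u' x)), ((u' x - 2 * sZ (f x)) ^ 2 - 1) ≤ 1535)
    (hL : ∃ x, Odd (u' x) ∧ ¬ (8 : ℤ) ∣ u' x - 2 * sZ (f x) - sZ (hb x))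
    (uf : (Fin (6 + 6) → Bool) → ℤ) (huf : ∀ y, W (fun x => signOf (f x)) y = (2 : ℝ) ^ 4 * (uf y : ℝ)) (hfall : ∀ y, Odd (uf y))
    (hEf : 512 ≤ #(univ.filter fun y : Fin (6 + 6) → Bool => uf y % 8 = 1 ∨ uf y % 8 = 7)) :
    (1984 : ℤ) ≤ ∑ x, (u' x - 2 * sZ (f x) - (fun x : Fin (6 + 6) → Bool => if Odd (u' x) then (if ¬ (8 : ℤ) ∣ u' x - 2 * sZ (f x) - sZ (hb x) then -3 * sZ (hb x) else sZ (hb x)) else 0) x) ^ 2 := by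
  classical
  set S := (fun x : Fin (6 + 6) → Bool => if Odd (u' x) then (if ¬ (8 : ℤ) ∣ u' x - 2 * sZ (f x) - sZ (hb x) then -3 * sZ (hb x) else sZ (hb x)) else 0) with hSdef
  set e : (Fin (6 + 6) → Bool) → ℤ := fun x => u' x - 2 * sZ (f x) with hedef
  set R := (V.filter fun r => ∀ v ∈ V, (hb x₀ ^^ hb (bxor x₀ r) ^^ hb (bxor x₀ v) ^^ hb (bxor (bxor x₀ r) v)) = false) with hRdef
  set SRf : (Fin (6 + 6) → Bool) → ℝ := fun y => ∑ t ∈ R, signOf (hb x₀ ^^ hb (bxor x₀ t)) * twist t y with hSRf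
  set Ef := univ.filter (fun y : Fin (6 + 6) → Bool => uf y % 8 = 1 ∨ uf y % 8 = 7) with hEfdef
  have hbe : ∀ z, hb z = decide ((u' z - 2 * sZ (f z)) % 4 = 3) := hhb
  have hsd := tzl5_hsd f g hf hg u' hu' V x₀ h0 hadd hcardV hP h4off
  have hsd' : ∀ x, Odd (u' x) → ∀ p ∈ V, ∀ q ∈ V, hb (bxor (bxor x p) q) =
      (hb x ^^ hb (bxor x p) ^^ hb (bxor x q) ^^ (hb x₀ ^^ hb (bxor x₀ p) ^^ hb (bxor x₀ q) ^^ hb (bxor (bxor x₀ p) q))) := by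
    intro x hx p hp q hq
    simp only [hbe]
    exact hsd x hx p hp q hq
  obtain ⟨t₀, ht₀, ht₀L⟩ := hL
  have hW : ∀ y, W (fun a => (((e a - S a : ℤ)) : ℝ)) y = 128 * signOf (g y) - 2 * W (fun x => signOf (f x)) y -
      (∑ x ∈ (univ.filter fun x : Fin (6 + 6) → Bool => Odd (u' x)), signOf (hb x) * twist x y - 4 * ∑ x ∈ (univ.filter fun z : Fin (6 + 6) → Bool => Odd (u' z) ∧ ¬ (8 : ℤ) ∣ u' z - 2 * sZ (f z) - sZ (hb z)), signOf (hb x) * twist x y) :=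
    fun y => tzu_W_eq f g u' hu' hb y
  -- pointwise lower bound
  have hpt : ∀ y, (1024 : ℝ) + 8192 * (if y ∈ Ef then (1 : ℝ) else 0) - 8192 * (if SRf y ≠ 0 then (1 : ℝ) else 0) ≤
      (W (fun a => (((e a - S a : ℤ)) : ℝ)) y) ^ 2 := by
    intro y
    obtain ⟨k, -, hk⟩ := tzt_Shat_val f g hf hg u' hu' V x₀ h0 hadd hcardV hP h4off hoff hb hhb hbud ⟨t₀, ht₀, ht₀L⟩ y
    rw [hW y, hk, huf y, ← tp_sZ_cast (g y)]
    have e1 : (128 * ((sZ (g y) : ℤ) : ℝ) - 2 * ((2 : ℝ) ^ 4 * (uf y : ℝ)) - 512 * (k : ℝ)) ^ 2 =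
        4 * (((64 * sZ (g y) - 16 * uf y - 128 * (2 * k)) ^ 2 : ℤ) : ℝ) := by push_cast; ring
    rw [e1]
    have hint := tzp_typeO_pt (uf y) (sZ (g y)) (2 * k) (hfall y) (tp_sZ_cases (g y))
    set X : ℝ := (((64 * sZ (g y) - 16 * uf y - 128 * (2 * k)) ^ 2 : ℤ) : ℝ) with hX
    have h256 : (256 : ℝ) ≤ X := by
      rw [hX]; exact_mod_cast hint.1
    by_cases hS0 : SRf y ≠ 0
    · rw [if_pos hS0]
      split_ifs <;> linarith
    · rw [if_neg hS0]
      have hS0' : SRf y = 0 := not_not.1 hS0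
      -- `M(y) = 0` and `T(y) = 0`, hence `k = 0`
      have hM : ∑ x ∈ (univ.filter fun x : Fin (6 + 6) → Bool => Odd (u' x)), signOf (hb x) * twist x y = 0 := by
        have hsq := tzl5_Shat_sq u' V x₀ h0 hadd hcardV hP hb hsd' y
        have : (∑ x ∈ (univ.filter fun x : Fin (6 + 6) → Bool => Odd (u' x)), signOf (hb x) * twist x y) ^ 2 = 0 := by rw [hsq]; simp only [SRf] at hS0'; rw [hS0', mul_zero]
        exact pow_eq_zero_iff (n := 2) (by norm_num) |>.1 this
      have hT : ∑ x ∈ (univ.filter fun z : Fin (6 + 6) → Bool => Odd (u' z) ∧ ¬ (8 : ℤ) ∣ u' z - 2 * sZ (f z) - sZ (hb z)), signOf (hb x) * twist x y = 0 := by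
        rw [tzt_T_eq f g hf hg u' hu' V x₀ h0 hadd hcardV hP h4off hoff hb hhb hbud ⟨t₀, ht₀, ht₀L⟩ ht₀ ht₀L y]
        simp only [SRf] at hS0'; rw [hS0', mul_zero]
      rw [hM, hT] at hk
      have hk0 : k = 0 := by
        have : (512 : ℝ) * (k : ℝ) = 0 := by linarith
        exact_mod_cast (mul_eq_zero.1 this).resolve_left (by norm_num)
      by_cases hyE : y ∈ Ef
      · rw [if_pos hyE]
        have h9 := hint.2 (mem_filter.1 hyE).2 (by rw [hk0]; ring)
        have h9' : (2304 : ℝ) ≤ X := by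
          rw [hX]; exact_mod_cast h9
        linarith
      · rw [if_neg hyE]
        linarith
  have hsum := sum_le_sum fun y (_ : y ∈ (univ : Finset (Fin (6 + 6) → Bool))) => hpt y
  have hindE : ∑ y, (if y ∈ Ef then (1 : ℝ) else 0) = #Ef := by
    rw [sum_boole]
    have : (univ.filter fun y => y ∈ Ef) = Ef := by ext y; simp
    rw [this]
  have hindS : ∑ y, (if SRf y ≠ 0 then (1 : ℝ) else 0) = 32 := by
    rw [sum_boole]
    have h32 := tzv_SR_count f g hf hg u' hu' V x₀ h0 hadd hcardV hP h4off hoff hb hhb hbud ⟨t₀, ht₀, ht₀L⟩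
    simp only [SRf]
    exact_mod_cast h32
  have hconst : ∑ _y : Fin (6 + 6) → Bool, (1024 : ℝ) = 4194304 := by
    rw [sum_const, card_univ, Fintype.card_fun, Fintype.card_bool, Fintype.card_fin, nsmul_eq_mul]; norm_num
  rw [sum_sub_distrib, sum_add_distrib, ← mul_sum, ← mul_sum, hindE, hindS, hconst] at hsum
  have hP2 := sum_W_sq (fun a => (((e a - S a : ℤ)) : ℝ))
  rw [hP2, show ((2 : ℝ) ^ (6 + 6)) = 4096 by norm_num] at hsum
  have h1 : ∑ x, ((((e x - S x : ℤ)) : ℝ)) ^ 2 = ((∑ x, (e x - S x) ^ 2 : ℤ) : ℝ) := by push_cast; rfl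
  rw [h1] at hsum
  have hE' : (512 : ℝ) ≤ #Ef := by exact_mod_cast hEf
  have : (1984 : ℝ) ≤ ((∑ x, (e x - S x) ^ 2 : ℤ) : ℝ) := by nlinarith
  exact_mod_cast this


end Summit.QuantumAdvantage.QuantumAdvantage.Theorems.CubicForrelation.NearExactIsExact

end
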